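import Literature.MathematicalPhysics.QuantumLattice.WilsonFermionGramRegularity
import Literature.MathematicalPhysics.QuantumFieldTheory.ConstructiveQFTWave0OddRPProofs
import Summits.QuantumFields.QCD.Theorems.HeatSlicedQuarksInterleavedFlowProperStubFineWeightAdmissibleSymm
import Summits.QuantumFields.QCD.Theorems.HeatSlicedQuarksInterleavedFlowProperStubFineWeightAdmissibleOddGram
import Summits.QuantumFields.QCD.Theorems.HeatSlicedQuarksInterleavedFlowProperStubFineWeightAdmissibleOddGramRegularity
import Summits.QuantumFields.QCD.Theorems.HeatSlicedQuarksInterleavedFlowProperStubFineWeightAdmissiblePartitionAlgebra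
import HarnessLib

/-!
# Fine-weight admissibility, part 7: the odd-torus Gram data with their vacuum data
(crux stmt-QuantumFields-18031 `HeatSlicedQuarks.InterleavedFlowProper`, line `Sketch`,
stub `stub_fineWeightAdmissible`, clause (2) — positivity of the signed partition function)

The single-flavour Gram data `(Φ, K)` of the antiperiodic Wilson determinant on the odd torus
(parts 3–5: `det D_AP[translateLow Y U] = ∑ Φ(z) K(U) conj Φ(ΘU)`) are repackaged together with
the vacuum vector `v` of the Cauchy–Binet expansion (part 6): `v` is real with `v_inl = 1`, it is
an eigenvector of the kernel, `∑_q K_{q' q}(V) v_q = λ(V) v_{q'}` with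
`λ(V) = det a_{S+1}[V] / k! > 0`, and the vacuum component of the feature vector is
`∑_q v_q Φ_q(V) = h(V) = k! ∏_{1 ≤ s ≤ S} det a_s[V] > 0`; `λ` and `h` are measurable, bounded above
and below by positive constants (continuity on the compact configuration space), `λ` depends only
on the spatial links of the shared slice `t = S + 1` and `h` only on spatial links
(`exists_oddGramData₂`). This is the input of the strict positivity of the partition function
(part 8). All statements are proved; no definitions.
-/

noncomputable section

-- The Gram index types are too deep for the default instance-search bounds (`DecidableEq` of the
-- function type of row selections, needed for the vacuum vector), cf. the tree's
-- `QuarksAsStableActionMarginalSiteRP`.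
set_option synthInstance.maxSize 2048
set_option synthInstance.maxHeartbeats 100000

namespace Summit.QuantumFields.QCD.Cruxes.InterleavedFlowProper.OffsetLastFormatHandover

namespace FineWeight

open Literature.MathematicalPhysics.QuantumFieldTheory Literature.MathematicalPhysics.QuantumLattice
open Literature.Probability.LatticeModels Literature.LinearAlgebra.Matrix
open _root_.MeasureTheory Matrix Complex Finset
open scoped ComplexOrder ComplexConjugate


/-! ## Packaging with the vacuum data -/

section Packaging2

variable {S N : ℕ} [NeZero N]

/-- **The odd-torus Gram data of one quark flavour together with its vacuum vector** (`m > -1`,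
`S ≥ 1`). Besides the content of `exists_oddGramData` (part 5): the vacuum vector `v` of the
Cauchy–Binet expansion (real, `v_inl = 1`), the eigenvalue function `λ(V) = det a_{S+1}[V] / k!`
of the kernel on `v` and the vacuum component `h(V) = k! · ∏_{1 ≤ s ≤ S} det a_s[V]` of the feature
vector, both measurable, bounded above and below by positive constants, `λ` depending only on the
spatial links of the shared slice and `h` only on spatial links. -/
theorem exists_oddGramData₂ (hS : 1 ≤ S) {m : ℝ} (hm : -1 < m) :
    ∃ (Φ : (((((Fin 3 → ZMod (2 * S + 1)) × Fin N) × Fin 2) ⊕ (((Fin 3 → ZMod (2 * S + 1)) × Fin N) × Fin 2)) →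
        (((((Fin 3 → ZMod (2 * S + 1)) × Fin N) × Fin 2) ⊕ (((Fin 3 → ZMod (2 * S + 1)) × Fin N) × Fin 2)) ⊕
          ((((Fin 3 → ZMod (2 * S + 1)) × Fin N) × Fin 2) ⊕ (((Fin 3 → ZMod (2 * S + 1)) × Fin N) × Fin 2)))) → GaugeConfig 4 (2 * S + 1) (Matrix.specialUnitaryGroup (Fin N) ℂ) → ℂ)
      (K : (((((Fin 3 → ZMod (2 * S + 1)) × Fin N) × Fin 2) ⊕ (((Fin 3 → ZMod (2 * S + 1)) × Fin N) × Fin 2)) →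
        (((((Fin 3 → ZMod (2 * S + 1)) × Fin N) × Fin 2) ⊕ (((Fin 3 → ZMod (2 * S + 1)) × Fin N) × Fin 2)) ⊕
          ((((Fin 3 → ZMod (2 * S + 1)) × Fin N) × Fin 2) ⊕ (((Fin 3 → ZMod (2 * S + 1)) × Fin N) × Fin 2)))) → (((((Fin 3 → ZMod (2 * S + 1)) × Fin N) × Fin 2) ⊕ (((Fin 3 → ZMod (2 * S + 1)) × Fin N) × Fin 2)) →
        (((((Fin 3 → ZMod (2 * S + 1)) × Fin N) × Fin 2) ⊕ (((Fin 3 → ZMod (2 * S + 1)) × Fin N) × Fin 2)) ⊕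
          ((((Fin 3 → ZMod (2 * S + 1)) × Fin N) × Fin 2) ⊕ (((Fin 3 → ZMod (2 * S + 1)) × Fin N) × Fin 2)))) → GaugeConfig 4 (2 * S + 1) (Matrix.specialUnitaryGroup (Fin N) ℂ) → ℂ)
      (v : (((((Fin 3 → ZMod (2 * S + 1)) × Fin N) × Fin 2) ⊕ (((Fin 3 → ZMod (2 * S + 1)) × Fin N) × Fin 2)) →
        (((((Fin 3 → ZMod (2 * S + 1)) × Fin N) × Fin 2) ⊕ (((Fin 3 → ZMod (2 * S + 1)) × Fin N) × Fin 2)) ⊕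
          ((((Fin 3 → ZMod (2 * S + 1)) × Fin N) × Fin 2) ⊕ (((Fin 3 → ZMod (2 * S + 1)) × Fin N) × Fin 2)))) → ℂ) (lam h : GaugeConfig 4 (2 * S + 1) (Matrix.specialUnitaryGroup (Fin N) ℂ) → ℝ),
      (∀ q, Measurable (Φ q)) ∧ (∀ q' q, Measurable (K q' q)) ∧
      (∃ C : ℝ, ∀ q V, ‖Φ q V‖ ≤ C) ∧ (∃ C : ℝ, ∀ q' q V, ‖K q' q V‖ ≤ C) ∧
      (∀ q, DependsOn (Φ q)
        ((WilsonOddRP.oPosEdges ∪ WilsonOddRP.lowerEdges : Finset (Edge 4 (2 * S + 1))) : Set (Edge 4 (2 * S + 1)))) ∧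
      (∀ q' q, DependsOn (K q' q) ((WilsonOddRP.oSharedEdges : Finset (Edge 4 (2 * S + 1))) : Set (Edge 4 (2 * S + 1)))) ∧
      (∀ V, (Matrix.of fun q' q => K q' q V).PosSemidef) ∧
      (∀ U Y, fermionDet (wilsonDiracAP (WilsonOddRP.translateLow Y U) m) =
        ∑ q', ∑ q, Φ q' (LatticeRP.splice WilsonOddRP.lowerEdges (U, Y)) * K q' q U *
          (starRingEnd ℂ) (Φ q U.timeReflect)) ∧
      (∀ q, (starRingEnd ℂ) (v q) = v q) ∧ (∃ C : ℝ, ∀ q, ‖v q‖ ≤ C) ∧ v Sum.inl = 1 ∧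
      Measurable lam ∧ Measurable h ∧
      (∃ l₀ : ℝ, 0 < l₀ ∧ ∀ V, l₀ ≤ lam V) ∧ (∃ C : ℝ, ∀ V, lam V ≤ C) ∧
      (∃ h₀ : ℝ, 0 < h₀ ∧ ∀ V, h₀ ≤ h V) ∧ (∃ C : ℝ, ∀ V, h V ≤ C) ∧
      (∀ U V : GaugeConfig 4 (2 * S + 1) (Matrix.specialUnitaryGroup (Fin N) ℂ), (∀ e : Edge 4 (2 * S + 1), e.2 ≠ 0 → (e.1 0).val = S + 1 → U e = V e) → lam U = lam V) ∧
      (∀ U V : GaugeConfig 4 (2 * S + 1) (Matrix.specialUnitaryGroup (Fin N) ℂ), (∀ e : Edge 4 (2 * S + 1), e.2 ≠ 0 → U e = V e) → h U = h V) ∧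
      (∀ V q', ∑ q, K q' q V * v q = (lam V : ℂ) * v q') ∧
      (∀ V, ∑ q, v q * Φ q V = (h V : ℂ)) := by
  -- the slice data and the Gram data, as functions
  set A : GaugeConfig 4 (2 * S + 1) (Matrix.specialUnitaryGroup (Fin N) ℂ) → Fin (2 * S + 1) →
      Matrix (((Fin 3 → ZMod (2 * S + 1)) × Fin N) × Fin 2) (((Fin 3 → ZMod (2 * S + 1)) × Fin N) × Fin 2) ℂ :=
    fun V t => sliceDiag (unitaryFundamentalRep (Fin N) ℂ) (apLift V) m t with hA
  set Ys : GaugeConfig 4 (2 * S + 1) (Matrix.specialUnitaryGroup (Fin N) ℂ) → Fin (2 * S + 1) → Matrix ((((Fin 3 → ZMod (2 * S + 1)) × Fin N) × Fin 2) ⊕ (((Fin 3 → ZMod (2 * S + 1)) × Fin N) × Fin 2)) ((((Fin 3 → ZMod (2 * S + 1)) × Fin N) × Fin 2) ⊕ (((Fin 3 → ZMod (2 * S + 1)) × Fin N) × Fin 2)) ℂ :=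
    fun V t => transferStep (A V t) (sliceOff (unitaryFundamentalRep (Fin N) ℂ) (apLift V) t) (A V t) with hYs
  set W : GaugeConfig 4 (2 * S + 1) (Matrix.specialUnitaryGroup (Fin N) ℂ) → Fin (2 * S + 1) → Matrix ((((Fin 3 → ZMod (2 * S + 1)) × Fin N) × Fin 2) ⊕ (((Fin 3 → ZMod (2 * S + 1)) × Fin N) × Fin 2)) ((((Fin 3 → ZMod (2 * S + 1)) × Fin N) × Fin 2) ⊕ (((Fin 3 → ZMod (2 * S + 1)) × Fin N) × Fin 2)) ℂ :=
    fun V t => linkBlock (sliceLink (unitaryFundamentalRep (Fin N) ℂ) (unitaryLift V) t) with hW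
  set G : GaugeConfig 4 (2 * S + 1) (Matrix.specialUnitaryGroup (Fin N) ℂ) → Matrix ((((Fin 3 → ZMod (2 * S + 1)) × Fin N) × Fin 2) ⊕ (((Fin 3 → ZMod (2 * S + 1)) × Fin N) × Fin 2)) ((((Fin 3 → ZMod (2 * S + 1)) × Fin N) × Fin 2) ⊕ (((Fin 3 → ZMod (2 * S + 1)) × Fin N) × Fin 2)) ℂ :=
    fun V => (List.ofFn fun s : Fin (S + 1) =>
      (W V (Fin.castLE (by omega) s))ᴴ * (if (s : ℕ) = 0 then 1 else Ys V (Fin.castLE (by omega) s))).reverse.prod with hG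
  set c : GaugeConfig 4 (2 * S + 1) (Matrix.specialUnitaryGroup (Fin N) ℂ) → ℂ := fun V => ∏ s : Fin S, (A V (Fin.castLE (by omega) s.succ)).det with hc
  have hA' : ∀ V t, A V t = sliceDiag (unitaryFundamentalRep (Fin N) ℂ) (apLift V) m t := fun _ _ => rfl
  have hYs' : ∀ V t, Ys V t = transferStep (A V t) (sliceOff (unitaryFundamentalRep (Fin N) ℂ) (apLift V) t) (A V t) :=
    fun _ _ => rfl
  have hW' : ∀ V t, W V t = linkBlock (sliceLink (unitaryFundamentalRep (Fin N) ℂ) (unitaryLift V) t) := fun _ _ => rfl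
  have hG' : ∀ V, G V = (List.ofFn fun s : Fin (S + 1) =>
      (W V (Fin.castLE (by omega) s))ᴴ * (if (s : ℕ) = 0 then 1 else Ys V (Fin.castLE (by omega) s))).reverse.prod :=
    fun _ => rfl
  have hc' : ∀ V, c V = ∏ s : Fin S, (A V (Fin.castLE (by omega) s.succ)).det := fun _ => rfl
  -- reality and positivity of the slice determinants
  have hApos : ∀ V t, 0 < (A V t).det := fun V t => det_sliceDiag_pos V hm t
  have hAre : ∀ V t, (((A V t).det.re : ℝ) : ℂ) = (A V t).det := fun V t =>
    Complex.conj_eq_iff_re.1 (conj_det_sliceDiag V hm t)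
  have hcpos : ∀ V, 0 < c V := fun V => Finset.prod_pos fun s _ => hApos V _
  have hcre : ∀ V, (((c V).re : ℝ) : ℂ) = c V := fun V => by
    refine Complex.conj_eq_iff_re.1 ?_
    rw [hc', map_prod]
    exact Finset.prod_congr rfl fun s _ => conj_det_sliceDiag V hm _
  -- the number `k!`
  set kf : ℕ := (Fintype.card ((((Fin 3 → ZMod (2 * S + 1)) × Fin N) × Fin 2) ⊕ (((Fin 3 → ZMod (2 * S + 1)) × Fin N) × Fin 2))).factorial with hkf
  have hkf0 : (0 : ℝ) < kf := Nat.cast_pos.2 (Nat.factorial_pos _)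
  -- continuity
  have hcontA : Continuous fun V => ((A V ⟨S + 1, by omega⟩).det).re :=
    Complex.continuous_re.comp (continuous_gramA A hA' _).matrix_det
  have hcontc : Continuous fun V => (c V).re := Complex.continuous_re.comp (continuous_gramc A hA' c hc')
  haveI := opensMeasurableSpace_gaugeConfig' (L := 2 * S + 1) (N := N)
  refine ⟨fun q V => c V * gramFeature (G V) q,
    fun q' q V => (A V ⟨S + 1, by omega⟩).det * gramCoupling 1 (Ys V ⟨S + 1, by omega⟩) q' q,
    fun q => ∑ τ : Equiv.Perm ((((Fin 3 → ZMod (2 * S + 1)) × Fin N) × Fin 2) ⊕ (((Fin 3 → ZMod (2 * S + 1)) × Fin N) × Fin 2)), if q = Sum.inl ∘ ⇑τ then ((Equiv.Perm.sign τ : ℤ) : ℂ) else 0,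
    fun V => ((A V ⟨S + 1, by omega⟩).det).re / kf, fun V => (c V).re * kf,
    fun q => measurable_gramFeature' A hA' Ys W hYs' hW' G hG' c hc' hm q,
    fun q' q => measurable_gramCoupling' A hA' Ys hYs' hS hm q' q,
    exists_bound_gramFeature' A hA' Ys W hYs' hW' G hG' c hc' hm,
    exists_bound_gramCoupling' A hA' Ys hYs' hS hm,
    fun q U V hUV => gramFeature_congr' A hA' Ys W hYs' hW' G hG' c hc' (fun e he1 he2 => hUV e ?_) q,
    fun q' q U V hUV => gramCoupling_congr' A hA' Ys hYs' hS (fun e he1 he2 => hUV e ?_) q' q,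
    fun V => posSemidef_gramCoupling' A hA' Ys hYs' hS hm V,
    fun U Y => fermionDet_wilsonDiracAP_translateLow_eq_sum_gram hS U Y hm A hA' Ys W hYs' hW' G hG' c hc',
    fun q => ?_, ⟨kf, fun q => ?_⟩, signVec_inl, (hcontA.div_const _).measurable, (hcontc.mul continuous_const).measurable,
    ?_, ?_, ?_, ?_, fun U V hUV => ?_, fun U V hUV => ?_, fun V q' => ?_, fun V => ?_⟩
  · -- the feature's links lie in `oPosEdges ∪ lowerEdges`
    rw [Finset.coe_union, Set.mem_union, Finset.mem_coe, Finset.mem_coe, WilsonOddRP.mem_oPosEdges,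
      WilsonOddRP.mem_lowerEdges, WilsonOddRP.IsOPosEdge, WilsonRP.IsLowerCross]
    rcases he2 with h0 | h1
    · by_cases h : 1 ≤ (e.1 0).val
      · exact Or.inl ⟨h, by omega⟩
      · exact Or.inr ⟨h0, by omega⟩
    · exact Or.inl ⟨h1, by omega⟩
  · -- the kernel's links lie in `oSharedEdges`
    rw [Finset.mem_coe, WilsonOddRP.mem_oSharedEdges, WilsonOddRP.IsOSharedEdge]
    exact ⟨he1, by omega⟩
  · -- `v` is real
    rw [map_sum]
    refine Finset.sum_congr rfl fun τ _ => ?_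
    split_ifs
    · rw [map_intCast]
    · rw [map_zero]
  · -- `‖v q‖ ≤ k!`
    refine (norm_sum_le _ _).trans ?_
    calc ∑ τ : Equiv.Perm ((((Fin 3 → ZMod (2 * S + 1)) × Fin N) × Fin 2) ⊕ (((Fin 3 → ZMod (2 * S + 1)) × Fin N) × Fin 2)), ‖(if q = Sum.inl ∘ ⇑τ then ((Equiv.Perm.sign τ : ℤ) : ℂ) else 0)‖
        ≤ ∑ _τ : Equiv.Perm ((((Fin 3 → ZMod (2 * S + 1)) × Fin N) × Fin 2) ⊕ (((Fin 3 → ZMod (2 * S + 1)) × Fin N) × Fin 2)), (1 : ℝ) := Finset.sum_le_sum fun τ _ => by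
          split_ifs
          · rcases Int.units_eq_one_or (Equiv.Perm.sign τ) with h | h <;> simp [h]
          · simp
      _ = kf := by rw [Finset.sum_const, Finset.card_univ, Fintype.card_perm, nsmul_eq_mul, mul_one]
  · -- positive lower bound of `λ`
    obtain ⟨V₀, -, hV₀⟩ := isCompact_univ.exists_isMinOn Set.univ_nonempty hcontA.continuousOn
    refine ⟨((A V₀ ⟨S + 1, by omega⟩).det).re / kf, div_pos ?_ hkf0, fun V => div_le_div_of_nonneg_right (hV₀ (Set.mem_univ V)) hkf0.le⟩
    have h := (Complex.lt_def.1 (hApos V₀ ⟨S + 1, by omega⟩)).1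
    simpa using h
  · -- upper bound of `λ`
    obtain ⟨C, hC⟩ := isCompact_univ.exists_bound_of_continuousOn hcontA.continuousOn
    exact ⟨C / kf, fun V => div_le_div_of_nonneg_right ((le_abs_self _).trans (hC V (Set.mem_univ V))) hkf0.le⟩
  · -- positive lower bound of `h`
    obtain ⟨V₀, -, hV₀⟩ := isCompact_univ.exists_isMinOn Set.univ_nonempty hcontc.continuousOn
    refine ⟨(c V₀).re * kf, mul_pos ?_ hkf0, fun V => mul_le_mul_of_nonneg_right (hV₀ (Set.mem_univ V)) hkf0.le⟩
    have h := (Complex.lt_def.1 (hcpos V₀)).1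
    simpa using h
  · -- upper bound of `h`
    obtain ⟨C, hC⟩ := isCompact_univ.exists_bound_of_continuousOn hcontc.continuousOn
    exact ⟨C * kf, fun V => mul_le_mul_of_nonneg_right ((le_abs_self _).trans (hC V (Set.mem_univ V))) hkf0.le⟩
  · -- `λ` depends only on the spatial links of the shared slice
    have hsp : ∀ (y : Fin 3 → ZMod (2 * S + 1)) (j : Fin 3),
        U (sliceSite (⟨S + 1, by omega⟩ : Fin (2 * S + 1)) y, j.succ) = V (sliceSite (⟨S + 1, by omega⟩ : Fin (2 * S + 1)) y, j.succ) :=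
      fun y j => hUV _ (Fin.succ_ne_zero j) (by rw [val_sliceSite_zero'])
    show (A U ⟨S + 1, by omega⟩).det.re / kf = (A V ⟨S + 1, by omega⟩).det.re / kf
    rw [hA', hA', (sliceDiag_sliceOff_congr hsp m).1]
  · -- `h` depends only on spatial links
    have hcc : c U = c V := by
      rw [hc', hc']
      refine Finset.prod_congr rfl fun s _ => ?_
      rw [hA', hA', (sliceDiag_sliceOff_congr (fun y j => hUV _ (Fin.succ_ne_zero j)) m).1]
    show (c U).re * kf = (c V).re * kf
    rw [hcc]
  · -- `v` is an eigenvector of the kernel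
    simp only [mul_assoc, ← Finset.mul_sum]
    rw [hYs', sum_gramCoupling_one_mul_signVec, ← mul_assoc]
    congr 1
    rw [Complex.ofReal_div, hAre, Complex.ofReal_natCast, div_eq_mul_inv]
  · -- the vacuum component of the feature vector
    have h1 : ∀ q : ((((Fin 3 → ZMod (2 * S + 1)) × Fin N) × Fin 2) ⊕ (((Fin 3 → ZMod (2 * S + 1)) × Fin N) × Fin 2)) →
        (((((Fin 3 → ZMod (2 * S + 1)) × Fin N) × Fin 2) ⊕ (((Fin 3 → ZMod (2 * S + 1)) × Fin N) × Fin 2)) ⊕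
          ((((Fin 3 → ZMod (2 * S + 1)) × Fin N) × Fin 2) ⊕ (((Fin 3 → ZMod (2 * S + 1)) × Fin N) × Fin 2))), (∑ τ : Equiv.Perm ((((Fin 3 → ZMod (2 * S + 1)) × Fin N) × Fin 2) ⊕ (((Fin 3 → ZMod (2 * S + 1)) × Fin N) × Fin 2)), if q = Sum.inl ∘ ⇑τ then ((Equiv.Perm.sign τ : ℤ) : ℂ) else 0) *
        (c V * gramFeature (G V) q) =
        c V * ((∑ τ : Equiv.Perm ((((Fin 3 → ZMod (2 * S + 1)) × Fin N) × Fin 2) ⊕ (((Fin 3 → ZMod (2 * S + 1)) × Fin N) × Fin 2)), if q = Sum.inl ∘ ⇑τ then ((Equiv.Perm.sign τ : ℤ) : ℂ) else 0) *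
          gramFeature (G V) q) := fun q => by ring
    simp only [h1, ← Finset.mul_sum, sum_signVec_mul_gramFeature]
    rw [Complex.ofReal_mul, hcre, Complex.ofReal_natCast]

end Packaging2

section Registered

/-- **Registered sub-goal `stubFW_gramData2` of `stub_fineWeightAdmissible`** (clause (2) input):
a positive, measurable, spatially local eigenvalue function `λ` for a real vacuum vector of the
odd-torus fermionic kernel exists (the content of `exists_oddGramData₂` stated compactly). -/
theorem stubFW_gramData2 : ∀ (S N : ℕ) [NeZero N], 1 ≤ S → ∀ m : ℝ, -1 < m →
    ∃ lam : GaugeConfig 4 (2 * S + 1) (Matrix.specialUnitaryGroup (Fin N) ℂ) → ℝ,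
      Measurable lam ∧ (∃ l₀ : ℝ, 0 < l₀ ∧ ∀ V, l₀ ≤ lam V) ∧ (∃ C : ℝ, ∀ V, lam V ≤ C) ∧
      ∀ U V : GaugeConfig 4 (2 * S + 1) (Matrix.specialUnitaryGroup (Fin N) ℂ),
        (∀ e : Edge 4 (2 * S + 1), e.2 ≠ 0 → (e.1 0).val = S + 1 → U e = V e) → lam U = lam V := by
  intro S N _ hS m hm
  obtain ⟨-, -, -, lam, -, -, -, -, -, -, -, -, -, -, -, -, hlm, -, hl0, hlC, -, -, hldep, -, -, -⟩ :=
    exists_oddGramData₂ (S := S) (N := N) hS hm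
  exact ⟨lam, hlm, hl0, hlC, hldep⟩

end Registered

end FineWeight

end Summit.QuantumFields.QCD.Cruxes.InterleavedFlowProper.OffsetLastFormatHandover

end
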